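import Literature.Topology.FourManifolds.RegularFamilyIsotopy
import Literature.Topology.FourManifolds.ThinHandleFunctionExposed
import Literature.Topology.FourManifolds.EuclideanMorseCharts
import Literature.Geometry.Riemannian.MeanConvexSurroundingDomain
import Literature.Geometry.Riemannian.MeanConvexSweepPrelim

/-!
# The mean-convex sweep of a handlebody in `ℝ^{m+1}`, one level at a time
# (Lawson–Michelsohn 1984, proof of Thm. 6.1 from Thm. 3.1; Milnor 1963, Thms. 3.1, 3.2)

Topic `Geometry/Riemannian` (fact seat
`provefact-Literature.Geometry.Riemannian.LawsonMichelsohn1984_surrounding`).  Everything here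
is **proved**; no named fact is introduced.

Lawson–Michelsohn prove Thm. 6.1 (surrounding a `1`-thin domain `D ⊂ ℝ^{m+1}` by a
hypersurface of positive mean curvature) from Thm. 3.1 (attaching a thin handle of codimension
`≥ 2` to a strictly mean-convex domain keeps it strictly mean convex) by sweeping a handle
decomposition of `D` without handles of index `≥ m`.  In the tree the sweep runs on `ℝ^{m+1}`,
on a smooth `f̃` (the normalised Seeley extension of the Morse function of the cobordism
`(D; ∅, ∂D)`), and carries the **invariant at a regular level `a`**: a diffeomorphism `Φ` of
`ℝ^{m+1}` fixing a neighbourhood `{F > -η}` of `ℝ^{m+1} ∖ D̊`, and a smooth `G` with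
`{G ≤ 0} = Φ{f̃ ≤ a}`, `dG ≠ 0` and strictly positive tangential Hessian trace (mean convexity)
along `{G = 0}`, and a compact sublevel set `{G ≤ s}`, `s > 0`.  This file proves the two
moves of the sweep:

* `sweep_band` — **across a band without critical values** `[a, b]` the invariant passes
  from `a` to `b` with the same `G` (Milnor 1963, Thm. 3.1: the regular family
  `f̃ ∘ Φ⁻¹ - (a + τ(b - a))`, `RegularFamily.exists_diffeomorph_image_eq`).
* `sweep_crit` — **across a critical level `c`** (critical points of index `≤ m - 1`, Morse
  charts of radius `R`, `4ε ≤ R²`): from the invariant at `c - ε` to the invariant at a level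
  `b ∈ [c + ε, c + 2ε]`, *given* the geometric handle theorem as the hypothesis `hG1`
  (Lawson–Michelsohn Thm. 3.1 in the explicit Euclidean form stated there: new charts `e'`,
  a new defining function `G'` with `{f̃∘Φ⁻¹ ≤ c - ε} ∪ discs ⊆ {G' < 0}`, mean convex and
  regular along `{G' = 0}`, and a transversality certificate — off the chart balls a common
  vector `v` with `df v > 0`, `dG' v > 0`; in the chart balls Milnor's field `(-x⃗, y⃗)`).  The
  passage is read through Milnor's thin-handle function `F_th` (`exists_thinHandleFunction'`,
  Milnor 1963, proof of Thm. 3.2, handles inside `{G' < 0}`): `{F_th ≤ c - ε₂}` is carried onto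
  `{f̃∘Φ⁻¹ ≤ c + ε₂}` by the regular family `F_th - (c - ε₂ + 2ε₂τ)` and onto `{G' ≤ 0}` by the
  regular family `(1 - τ)(F_th - (c - ε₂)) + τ G'`, whose regularity is exactly the certificate.

The assembly over all critical levels and the discharge of the fact are in
`MeanConvexSweep.lean`.

## References

* H. B. Lawson, Jr., M.-L. Michelsohn, *Embedding and surrounding with positive mean curvature*,
  Invent. Math. 77 (1984) 399–419, Thms. 3.1, 6.1. [LawsonMichelsohn1984]
* J. Milnor, *Morse theory*, Ann. of Math. Studies 51 (1963), Thms. 3.1, 3.2. [Milnor1963]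
-/

noncomputable section

open scoped Manifold ContDiff Topology
open Set Function Filter Metric Literature.Topology.FourManifolds

namespace Literature.Geometry.Riemannian

variable {m : ℕ}

/-! ### Helpers -/

section Helpers

variable {E : Type*} [NormedAddCommGroup E] [NormedSpace ℝ E]

/-- Image of a set `{x | p x}` under a diffeomorphism. [folklore] -/
theorem image_setOf_diffeo (Φ : E ≃ₘ⟮𝓘(ℝ, E), 𝓘(ℝ, E)⟯ E) (p : E → Prop) :
    Φ '' {x | p x} = {y | p (Φ.symm y)} := by
  ext y
  constructor
  · rintro ⟨x, hx, rfl⟩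
    simpa using hx
  · intro hy
    exact ⟨Φ.symm y, hy, Φ.apply_symm_apply y⟩

/-- The derivative of `g ∘ Φ⁻¹` vanishes iff that of `g` does (chain rule with a
diffeomorphism). [folklore] -/
theorem fderiv_comp_diffeo_symm_eq_zero_iff (Φ : E ≃ₘ⟮𝓘(ℝ, E), 𝓘(ℝ, E)⟯ E) {g : E → ℝ} {y : E}
    (hg : DifferentiableAt ℝ g (Φ.symm y)) :
    fderiv ℝ (g ∘ Φ.symm) y = 0 ↔ fderiv ℝ g (Φ.symm y) = 0 := by
  have hΦd : Differentiable ℝ (Φ : E → E) :=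
    (contMDiff_iff_contDiff.1 Φ.contMDiff).differentiable (by simp)
  have hΦsd : Differentiable ℝ (Φ.symm : E → E) :=
    (contMDiff_iff_contDiff.1 Φ.symm.contMDiff).differentiable (by simp)
  have hchain : fderiv ℝ (g ∘ Φ.symm) y = (fderiv ℝ g (Φ.symm y)).comp (fderiv ℝ Φ.symm y) :=
    fderiv_comp y hg (hΦsd y)
  have hid : (fderiv ℝ Φ.symm y).comp (fderiv ℝ Φ (Φ.symm y)) = ContinuousLinearMap.id ℝ E := by
    have h1 : fderiv ℝ (Φ.symm ∘ Φ) (Φ.symm y) =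
        (fderiv ℝ Φ.symm (Φ (Φ.symm y))).comp (fderiv ℝ Φ (Φ.symm y)) :=
      fderiv_comp _ (hΦsd _) (hΦd _)
    rw [Φ.apply_symm_apply] at h1
    rw [← h1]
    have : (Φ.symm ∘ Φ : E → E) = id := funext fun x => Φ.symm_apply_apply x
    rw [this, fderiv_id]
  constructor
  · intro h
    rw [hchain] at h
    have : fderiv ℝ g (Φ.symm y) =
        ((fderiv ℝ g (Φ.symm y)).comp (fderiv ℝ Φ.symm y)).comp (fderiv ℝ Φ (Φ.symm y)) := by
      rw [ContinuousLinearMap.comp_assoc, hid, ContinuousLinearMap.comp_id]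
    rw [this, h, ContinuousLinearMap.zero_comp]
  · intro h
    rw [hchain, h, ContinuousLinearMap.zero_comp]

/-- A diffeomorphism equal to the identity on `{F > -η}` maps `{F ≤ -η}` into itself.
[folklore] -/
theorem apply_le_of_forall_eq (Φ : E ≃ₘ⟮𝓘(ℝ, E), 𝓘(ℝ, E)⟯ E) {F : E → ℝ} {η : ℝ}
    (hΦ : ∀ x, -η < F x → Φ x = x) {x : E} (hx : F x ≤ -η) : F (Φ x) ≤ -η := by
  by_contra h
  rw [not_le] at h
  have h1 : Φ (Φ x) = Φ x := hΦ (Φ x) h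
  have h2 : Φ x = x := Φ.injective h1
  rw [h2] at h
  exact absurd hx (not_le.2 h)

/-- The inverse of a diffeomorphism equal to the identity on `{F > -η}` is the identity there.
[folklore] -/
theorem symm_apply_eq_of_forall_eq (Φ : E ≃ₘ⟮𝓘(ℝ, E), 𝓘(ℝ, E)⟯ E) {F : E → ℝ} {η : ℝ}
    (hΦ : ∀ x, -η < F x → Φ x = x) {x : E} (hx : -η < F x) : Φ.symm x = x := by
  conv_lhs => rw [← hΦ x hx]
  exact Φ.symm_apply_apply x

/-- **Depth of an image**: if `Φ = id` on `{F > -η}` and `F ≤ -η₁` on `S`, then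
`F ≤ -min η η₁` on `Φ(S)`. [folklore] -/
theorem apply_image_le (Φ : E ≃ₘ⟮𝓘(ℝ, E), 𝓘(ℝ, E)⟯ E) {F : E → ℝ} {η η₁ : ℝ}
    (hΦ : ∀ x, -η < F x → Φ x = x) {S : Set E} (hS : ∀ x ∈ S, F x ≤ -η₁) :
    ∀ y ∈ Φ '' S, F y ≤ -min η η₁ := by
  rintro _ ⟨x, hx, rfl⟩
  rcases lt_or_ge (-η) (F x) with h | h
  · rw [hΦ x h]
    exact (hS x hx).trans (neg_le_neg (min_le_right _ _))
  · exact (apply_le_of_forall_eq Φ hΦ h).trans (neg_le_neg (min_le_left _ _))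

/-- **Shrinking compact sublevel sets**: if `{G ≤ s}` is compact (`s > 0`) and `O` is an open
set containing `{G ≤ 0}`, then `{G ≤ s₀} ⊆ O` for some `s₀ ∈ (0, s]`. [folklore] -/
theorem exists_setOf_le_subset {X : Type*} [TopologicalSpace X] {G : X → ℝ} (hG : Continuous G)
    {s : ℝ} (hs : 0 < s) (hc : IsCompact {x | G x ≤ s}) {O : Set X} (hO : IsOpen O)
    (hGO : {x | G x ≤ 0} ⊆ O) :
    ∃ s₀, 0 < s₀ ∧ s₀ ≤ s ∧ {x | G x ≤ s₀} ⊆ O := by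
  have hAc : IsCompact ({x | G x ≤ s} ∩ Oᶜ) := hc.inter_right hO.isClosed_compl
  have hpos : ∀ x ∈ {x | G x ≤ s} ∩ Oᶜ, 0 < G x := fun x hx => by
    by_contra h
    exact hx.2 (hGO (not_lt.1 h))
  obtain ⟨κ, hκ, hκle⟩ := exists_pos_lowerBound_of_isCompact hG hAc hpos
  refine ⟨min s (κ / 2), lt_min hs (by positivity), min_le_left _ _, fun x hx => ?_⟩
  by_contra hxO
  have h1 : G x ≤ s := (show G x ≤ min s (κ / 2) from hx).trans (min_le_left _ _)
  have h2 := hκle x ⟨h1, hxO⟩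
  have h3 : G x ≤ κ / 2 := (show G x ≤ min s (κ / 2) from hx).trans (min_le_right _ _)
  linarith

/-- A compact set on which a continuous `F` is negative lies in `{F ≤ -η₁}` for some `η₁ > 0`.
[folklore] -/
theorem exists_pos_forall_le_neg {X : Type*} [TopologicalSpace X] {F : X → ℝ} (hF : Continuous F)
    {S : Set X} (hS : IsCompact S) (hneg : ∀ x ∈ S, F x < 0) :
    ∃ η₁, 0 < η₁ ∧ ∀ x ∈ S, F x ≤ -η₁ := by
  obtain ⟨κ, hκ, hκle⟩ := exists_pos_lowerBound_of_isCompact (ψ := fun x => -F x)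
    hF.neg hS fun x hx => by simpa using hneg x hx
  exact ⟨κ, hκ, fun x hx => by have := hκle x hx; linarith⟩

end Helpers

/-! ### Model-space helpers -/

/-- On the descending plane `{η⃗ = 0}` the expanding sum of squares vanishes. [folklore] -/
theorem sqSumGE_eq_zero_of_plane {n : ℕ} {k : ℕ} {y : EuclideanSpace ℝ (Fin n)}
    (hy : ∀ i : Fin n, k ≤ i.val → y i = 0) : sqSumGE k y = 0 :=
  Finset.sum_eq_zero fun i hi => by
    obtain ⟨-, hi⟩ := Finset.mem_filter.1 hi
    rw [hy i hi]; ring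

/-- On the descending plane, `‖y‖² = ξ(y)`. [folklore] -/
theorem norm_sq_eq_sqSumLT_of_plane {n : ℕ} {k : ℕ} {y : EuclideanSpace ℝ (Fin n)}
    (hy : ∀ i : Fin n, k ≤ i.val → y i = 0) : ‖y‖ ^ 2 = sqSumLT k y := by
  rw [← sqSumLT_add_sqSumGE k y, sqSumGE_eq_zero_of_plane hy, add_zero]

/-! ### Across a band without critical values (Milnor 1963, Thm. 3.1) -/

/-- **The band move of the sweep.**  Let `g` be smooth on `ℝ^{m+1}` with compact sublevel sets
below `2` and `{g < 1} ⊆ {F < 0}`, let `[a, b]` (`b < 1`) contain no critical value of `g`, and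
let `Φ` be a diffeomorphism equal to the identity on `{F > -η}`.  Then there is a diffeomorphism
`Φ'`, equal to the identity on some `{F > -η'}`, with `Φ'{g ≤ b} = Φ{g ≤ a}` (the regular
family `g ∘ Φ⁻¹ - (a + τ(b - a))`, `τ ∈ [0, 1]`). [cite: Milnor1963, Thm. 3.1] -/
theorem sweep_band {F g : EuclideanSpace ℝ (Fin (m + 1)) → ℝ} (hF : Continuous F)
    (hg : ContDiff ℝ ∞ g) (hsub1 : ∀ x, g x < 1 → F x < 0)
    (hcpt : ∀ s, s < 2 → IsCompact {x | g x ≤ s})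
    {a b : ℝ} (hab : a ≤ b) (hb1 : b < 1) (hreg : ∀ x, a ≤ g x → g x ≤ b → fderiv ℝ g x ≠ 0)
    {η : ℝ} (hη : 0 < η)
    (Φ : EuclideanSpace ℝ (Fin (m + 1)) ≃ₘ⟮𝓘(ℝ, EuclideanSpace ℝ (Fin (m + 1))),
      𝓘(ℝ, EuclideanSpace ℝ (Fin (m + 1)))⟯ EuclideanSpace ℝ (Fin (m + 1)))
    (hΦ : ∀ x, -η < F x → Φ x = x) :
    ∃ (η' : ℝ) (Φ' : EuclideanSpace ℝ (Fin (m + 1)) ≃ₘ⟮𝓘(ℝ, EuclideanSpace ℝ (Fin (m + 1))),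
      𝓘(ℝ, EuclideanSpace ℝ (Fin (m + 1)))⟯ EuclideanSpace ℝ (Fin (m + 1))),
      0 < η' ∧ (∀ x, -η' < F x → Φ' x = x) ∧ Φ' '' {x | g x ≤ b} = Φ '' {x | g x ≤ a} := by
  -- the pushed function and the family
  set gs : EuclideanSpace ℝ (Fin (m + 1)) → ℝ := g ∘ Φ.symm with hgs
  have hΦsc : ContDiff ℝ ∞ (Φ.symm : EuclideanSpace ℝ (Fin (m + 1)) → EuclideanSpace ℝ (Fin (m + 1))) :=
    contMDiff_iff_contDiff.1 Φ.symm.contMDiff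
  have hgsc : ContDiff ℝ ∞ gs := hg.comp hΦsc
  have hgd : Differentiable ℝ g := hg.differentiable (by simp)
  set Fam : ℝ × EuclideanSpace ℝ (Fin (m + 1)) → ℝ := fun q => gs q.2 - (a + q.1 * (b - a))
    with hFam
  have hFamc : ContDiff ℝ ∞ Fam :=
    (hgsc.comp contDiff_snd).sub (contDiff_const.add (contDiff_fst.mul contDiff_const))
  have hFamτ : ∀ τ, (fun y => Fam (τ, y)) = fun y => gs y - (a + τ * (b - a)) := fun τ => rfl
  -- sublevel sets of the pushed function
  have himg : ∀ s, Φ '' {x | g x ≤ s} = {y | gs y ≤ s} := fun s =>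
    image_setOf_diffeo Φ fun x => g x ≤ s
  -- regularity of the family
  have hregF : ∀ τ ∈ Icc (0 : ℝ) 1, ∀ x, Fam (τ, x) = 0 →
      fderiv ℝ (fun y => Fam (τ, y)) x ≠ 0 := by
    intro τ hτ x hx
    rw [hFamτ, fderiv_sub_const]
    have hval : gs x = a + τ * (b - a) := by
      change gs x - (a + τ * (b - a)) = 0 at hx; linarith
    have h1 : a ≤ g (Φ.symm x) := by
      change g (Φ.symm x) = _ at hval
      rw [hval]; nlinarith [hτ.1, hτ.2]
    have h2 : g (Φ.symm x) ≤ b := by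
      change g (Φ.symm x) = _ at hval
      rw [hval]; nlinarith [hτ.1, hτ.2]
    rw [Ne, fderiv_comp_diffeo_symm_eq_zero_iff Φ (hgd _)]
    exact hreg _ h1 h2
  -- compact bands
  set ε₀ : ℝ := (1 - b) / 2 with hε₀
  have hε₀pos : 0 < ε₀ := by rw [hε₀]; linarith
  set S : Set (EuclideanSpace ℝ (Fin (m + 1))) := {x | g x ≤ b + ε₀} with hS
  have hSc : IsCompact S := hcpt _ (by rw [hε₀]; linarith)
  set K : Set (EuclideanSpace ℝ (Fin (m + 1))) := Φ '' S with hK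
  have hKc : IsCompact K := hSc.image Φ.continuous
  have hKF : ∀ τ ∈ Icc (0 : ℝ) 1, ∀ x, |Fam (τ, x)| ≤ ε₀ → x ∈ K := by
    intro τ hτ x hx
    have h1 : gs x ≤ b + ε₀ := by
      have := (abs_le.1 hx).2
      change gs x - (a + τ * (b - a)) ≤ ε₀ at this
      nlinarith [hτ.1, hτ.2]
    rw [hK, himg]
    exact h1
  obtain ⟨Ψ, hΨle, -, -, -, hΨK⟩ :=
    RegularFamily.exists_diffeomorph_image_eq hFamc hKc hε₀pos hKF hregF
  -- the endpoints of the family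
  have h0 : {x | Fam (0, x) ≤ 0} = {y | gs y ≤ a} := by
    ext x; simp [hFam]
  have h1 : {x | Fam (1, x) ≤ 0} = {y | gs y ≤ b} := by
    ext x
    simp only [hFam, mem_setOf_eq, one_mul, add_sub_cancel, sub_nonpos]
  rw [h0, h1] at hΨle
  -- depth of `K`
  have hSneg : ∀ x ∈ S, F x < 0 := fun x hx =>
    hsub1 x (lt_of_le_of_lt hx (by rw [hε₀]; linarith))
  obtain ⟨η₁, hη₁, hη₁S⟩ := exists_pos_forall_le_neg hF hSc hSneg
  have hKdeep : ∀ y ∈ K, F y ≤ -min η η₁ := apply_image_le Φ hΦ hη₁S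
  refine ⟨min η η₁, Φ.trans Ψ.symm, lt_min hη hη₁, fun x hx => ?_, ?_⟩
  · -- identity region
    have hxK : x ∉ K := fun h => by have := hKdeep x h; linarith
    have h1 : Φ x = x := hΦ x (lt_of_le_of_lt (neg_le_neg (min_le_left _ _)) hx)
    show Ψ.symm (Φ x) = x
    rw [h1]
    conv_lhs => rw [← hΨK x hxK]
    exact Ψ.symm_apply_apply x
  · -- the sublevel identity
    show (Φ.trans Ψ.symm) '' {x | g x ≤ b} = Φ '' {x | g x ≤ a}
    rw [Diffeomorph.coe_trans, image_comp, himg, himg, ← hΨle, ← image_comp]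
    have : (Ψ.symm ∘ Ψ : EuclideanSpace ℝ (Fin (m + 1)) → EuclideanSpace ℝ (Fin (m + 1))) = id :=
      funext fun x => Ψ.symm_apply_apply x
    rw [this, image_id]

/-! ### Across a critical level (Milnor 1963, Thm. 3.2; Lawson–Michelsohn 1984, Thm. 3.1) -/

set_option maxHeartbeats 800000 in
/-- **The critical move of the sweep, given the mean-convex handle theorem `hG1`.**  Let `g` be
smooth on `ℝ^{m+1}` with compact sublevel sets below `2` and `{g < 1} ⊆ {F < 0}`; let `c` be a
critical value, `P` the set of critical points of `g` at level `c` — more precisely all critical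
points with value in `[c - 4ε, c + 4ε]` — with indices `λ_p ≤ m - 1` and disjoint Morse charts
`e₀_p` of radius `R`, `4ε ≤ R²`, `c + 5ε < 1`; and let `(Φ, G)` be the invariant of the sweep
at the level `c - ε` (`Φ = id` on `{F > -η}`, `{G ≤ 0} = Φ{g ≤ c - ε}`, `G` regular and
strictly mean convex along `{G = 0}`).  Then the invariant holds at a level
`b ∈ [c + ε, c + 2ε]`. [cite: LawsonMichelsohn1984, Thm. 3.1 and proof of Thm. 6.1;
Milnor1963, Thm. 3.2 (proof)] -/
theorem sweep_crit
    (hG1 : ∀ (f G : EuclideanSpace ℝ (Fin (m + 1)) → ℝ) (c ε R : ℝ) (P : Finset (EuclideanSpace ℝ (Fin (m + 1)))) (lam : EuclideanSpace ℝ (Fin (m + 1)) → ℕ)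
      (e : EuclideanSpace ℝ (Fin (m + 1)) → OpenPartialHomeomorph (EuclideanSpace ℝ (Fin (m + 1))) (EuclideanSpace ℝ (Fin (m + 1)))) (U : Set (EuclideanSpace ℝ (Fin (m + 1)))),
      ContDiff ℝ ∞ f → ContDiff ℝ ∞ G → 0 < ε → 0 < R → 2 * ε ≤ R ^ 2 →
      (∀ p ∈ P, lam p + 1 ≤ m) →
      (∀ p ∈ P, e p ∈ IsManifold.maximalAtlas (𝓡 (m + 1)) ∞ (EuclideanSpace ℝ (Fin (m + 1)))) →
      (∀ p ∈ P, p ∈ (e p).source ∧ e p p = 0) →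
      (∀ p ∈ P, Metric.closedBall (0 : EuclideanSpace ℝ (Fin (m + 1))) R ⊆ (e p).target) →
      (∀ p ∈ P, ∀ y ∈ (e p).target,
        f ((e p).symm y) = c - sqSumLT (lam p) y + sqSumGE (lam p) y) →
      (∀ p ∈ P, ∀ p' ∈ P, p ≠ p' → Disjoint ((e p).symm '' Metric.closedBall (0 : EuclideanSpace ℝ (Fin (m + 1))) R)
        ((e p').symm '' Metric.closedBall (0 : EuclideanSpace ℝ (Fin (m + 1))) R)) →
      IsCompact {x | f x ≤ c + ε} →
      {x | G x ≤ 0} = {x | f x ≤ c - ε} →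
      (∃ s, 0 < s ∧ IsCompact {x | G x ≤ s}) →
      (∀ x, f x = c - ε → fderiv ℝ f x ≠ 0) →
      (∀ x, G x = 0 → fderiv ℝ G x ≠ 0) →
      (∀ x, G x = 0 → ∀ v : Fin m → EuclideanSpace ℝ (Fin (m + 1)), Orthonormal ℝ v →
        (∀ i, fderiv ℝ G x (v i) = 0) → 0 < ∑ i, iteratedFDeriv ℝ 2 G x ![v i, v i]) →
      IsOpen U →
      (∀ p ∈ P, ∀ y : EuclideanSpace ℝ (Fin (m + 1)), (∀ i : Fin (m + 1), lam p ≤ i.val → y i = 0) →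
        sqSumLT (lam p) y ≤ ε → (e p).symm y ∈ U) →
      ∃ (e' : EuclideanSpace ℝ (Fin (m + 1)) → OpenPartialHomeomorph (EuclideanSpace ℝ (Fin (m + 1))) (EuclideanSpace ℝ (Fin (m + 1)))) (G' : EuclideanSpace ℝ (Fin (m + 1)) → ℝ),
        (∀ p ∈ P, e' p ∈ IsManifold.maximalAtlas (𝓡 (m + 1)) ∞ (EuclideanSpace ℝ (Fin (m + 1)))) ∧
        (∀ p ∈ P, p ∈ (e' p).source ∧ e' p p = 0) ∧
        (∀ p ∈ P, Metric.closedBall (0 : EuclideanSpace ℝ (Fin (m + 1))) R ⊆ (e' p).target) ∧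
        (∀ p ∈ P, ∀ y ∈ (e' p).target,
          f ((e' p).symm y) = c - sqSumLT (lam p) y + sqSumGE (lam p) y) ∧
        (∀ p ∈ P, ∀ p' ∈ P, p ≠ p' → Disjoint ((e' p).symm '' Metric.closedBall (0 : EuclideanSpace ℝ (Fin (m + 1))) R)
          ((e' p').symm '' Metric.closedBall (0 : EuclideanSpace ℝ (Fin (m + 1))) R)) ∧
        ContDiff ℝ ∞ G' ∧ {x | G' x ≠ G x} ⊆ U ∧
        (∀ x, f x ≤ c - ε → G' x ≤ 0) ∧
        (∀ p ∈ P, ∀ y : EuclideanSpace ℝ (Fin (m + 1)), (∀ i : Fin (m + 1), lam p ≤ i.val → y i = 0) →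
          sqSumLT (lam p) y ≤ ε → G' ((e' p).symm y) < 0) ∧
        (∃ s, 0 < s ∧ IsCompact {x | G' x ≤ s}) ∧
        (∀ x, G' x = 0 → fderiv ℝ G' x ≠ 0) ∧
        (∀ x, G' x = 0 → ∀ v : Fin m → EuclideanSpace ℝ (Fin (m + 1)), Orthonormal ℝ v →
          (∀ i, fderiv ℝ G' x (v i) = 0) → 0 < ∑ i, iteratedFDeriv ℝ 2 G' x ![v i, v i]) ∧
        (∃ δ, 0 < δ ∧ ∀ x, G' x ≤ 0 → c - ε - δ < f x →
          (x ∉ (⋃ p ∈ P, (e' p).symm '' Metric.closedBall (0 : EuclideanSpace ℝ (Fin (m + 1))) R) ∧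
            ∃ v, 0 < fderiv ℝ f x v ∧ 0 ≤ fderiv ℝ G' x v) ∨
          (∃ p ∈ P, ∃ y ∈ Metric.closedBall (0 : EuclideanSpace ℝ (Fin (m + 1))) R, x = (e' p).symm y ∧
            (y ≠ 0 → ∃ a b : ℝ, 0 ≤ a ∧ 0 ≤ b ∧
              0 < a * sqSumLT (lam p) y + (a + 2 * b) * sqSumGE (lam p) y ∧
              0 ≤ fderiv ℝ (G' ∘ (e' p).symm) y
                (a • milnorModelField (lam p) y + b • (y + milnorModelField (lam p) y))))))
    {F g : EuclideanSpace ℝ (Fin (m + 1)) → ℝ} (hF : Continuous F)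
    (hg : ContDiff ℝ ∞ g) (hsub1 : ∀ x, g x < 1 → F x < 0)
    (hcpt : ∀ s, s < 2 → IsCompact {x | g x ≤ s})
    {c ε R : ℝ} (hε : 0 < ε) (hR : 0 < R) (hRε : 4 * ε ≤ R ^ 2) (hc5 : c + 5 * ε < 1)
    (P : Finset (EuclideanSpace ℝ (Fin (m + 1)))) (lam : EuclideanSpace ℝ (Fin (m + 1)) → ℕ) (e₀ : EuclideanSpace ℝ (Fin (m + 1)) → OpenPartialHomeomorph (EuclideanSpace ℝ (Fin (m + 1))) (EuclideanSpace ℝ (Fin (m + 1))))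
    (he₀ : ∀ p ∈ P, e₀ p ∈ IsManifold.maximalAtlas (𝓡 (m + 1)) ∞ (EuclideanSpace ℝ (Fin (m + 1))))
    (hpe₀ : ∀ p ∈ P, p ∈ (e₀ p).source ∧ e₀ p p = 0)
    (hball₀ : ∀ p ∈ P, Metric.closedBall (0 : EuclideanSpace ℝ (Fin (m + 1))) R ⊆ (e₀ p).target)
    (hquad₀ : ∀ p ∈ P, ∀ y ∈ (e₀ p).target,
      g ((e₀ p).symm y) = c - sqSumLT (lam p) y + sqSumGE (lam p) y)
    (hdisj₀ : ∀ p ∈ P, ∀ p' ∈ P, p ≠ p' → Disjoint ((e₀ p).symm '' Metric.closedBall (0 : EuclideanSpace ℝ (Fin (m + 1))) R)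
      ((e₀ p').symm '' Metric.closedBall (0 : EuclideanSpace ℝ (Fin (m + 1))) R))
    (hlam : ∀ p ∈ P, lam p + 1 ≤ m)
    (hcomplete : ∀ x, g x ∈ Icc (c - 4 * ε) (c + 4 * ε) → fderiv ℝ g x = 0 → x ∈ P)
    {η : ℝ} (hη : 0 < η) (Φ : EuclideanSpace ℝ (Fin (m + 1)) ≃ₘ⟮𝓘(ℝ, EuclideanSpace ℝ (Fin (m + 1))),
      𝓘(ℝ, EuclideanSpace ℝ (Fin (m + 1)))⟯ EuclideanSpace ℝ (Fin (m + 1)))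
    (hΦ : ∀ x, -η < F x → Φ x = x)
    {G : EuclideanSpace ℝ (Fin (m + 1)) → ℝ} (hGc : ContDiff ℝ ∞ G) (hGset : {x | G x ≤ 0} = Φ '' {x | g x ≤ c - ε})
    (hGcpt : ∃ s, 0 < s ∧ IsCompact {x | G x ≤ s}) (hGreg : ∀ x, G x = 0 → fderiv ℝ G x ≠ 0)
    (hGmc : ∀ x, G x = 0 → ∀ v : Fin m → EuclideanSpace ℝ (Fin (m + 1)), Orthonormal ℝ v →
      (∀ i, fderiv ℝ G x (v i) = 0) → 0 < ∑ i, iteratedFDeriv ℝ 2 G x ![v i, v i]) :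
    ∃ (b η' : ℝ) (Φ' : EuclideanSpace ℝ (Fin (m + 1)) ≃ₘ⟮𝓘(ℝ, EuclideanSpace ℝ (Fin (m + 1))),
      𝓘(ℝ, EuclideanSpace ℝ (Fin (m + 1)))⟯ EuclideanSpace ℝ (Fin (m + 1))) (G' : EuclideanSpace ℝ (Fin (m + 1)) → ℝ),
      c + ε ≤ b ∧ b ≤ c + 2 * ε ∧ 0 < η' ∧ (∀ x, -η' < F x → Φ' x = x) ∧ ContDiff ℝ ∞ G' ∧
      {x | G' x ≤ 0} = Φ' '' {x | g x ≤ b} ∧ (∃ s, 0 < s ∧ IsCompact {x | G' x ≤ s}) ∧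
      (∀ x, G' x = 0 → fderiv ℝ G' x ≠ 0) ∧
      (∀ x, G' x = 0 → ∀ v : Fin m → EuclideanSpace ℝ (Fin (m + 1)), Orthonormal ℝ v →
        (∀ i, fderiv ℝ G' x (v i) = 0) → 0 < ∑ i, iteratedFDeriv ℝ 2 G' x ![v i, v i]) := by
  classical
  -- 0. the pushed function
  have hΦsc : ContDiff ℝ ∞ (Φ.symm : EuclideanSpace ℝ (Fin (m + 1)) → EuclideanSpace ℝ (Fin (m + 1))) := contMDiff_iff_contDiff.1 Φ.symm.contMDiff
  set gs : EuclideanSpace ℝ (Fin (m + 1)) → ℝ := g ∘ Φ.symm with hgs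
  have hgsc : ContDiff ℝ ∞ gs := hg.comp hΦsc
  have hgd : Differentiable ℝ g := hg.differentiable (by simp)
  have hgsd : Differentiable ℝ gs := hgsc.differentiable (by simp)
  have himg : ∀ s, Φ '' {x | g x ≤ s} = {y | gs y ≤ s} := fun s =>
    image_setOf_diffeo Φ fun x => g x ≤ s
  have hgscpt : ∀ s, s < 2 → IsCompact {y | gs y ≤ s} := fun s hs => by
    rw [← himg]; exact (hcpt s hs).image Φ.continuous
  have hcritiff : ∀ y, fderiv ℝ gs y = 0 ↔ fderiv ℝ g (Φ.symm y) = 0 := fun y =>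
    fderiv_comp_diffeo_symm_eq_zero_iff Φ (hgd _)
  -- the critical points of `gs` near the level `c`
  set P' : Finset (EuclideanSpace ℝ (Fin (m + 1))) := P.image Φ with hP'
  have hmemP' : ∀ q, q ∈ P' → Φ.symm q ∈ P := fun q hq => by
    obtain ⟨p, hp, rfl⟩ := Finset.mem_image.1 hq
    rwa [Φ.symm_apply_apply]
  have hcomplete' : ∀ y, gs y ∈ Icc (c - 4 * ε) (c + 4 * ε) → fderiv ℝ gs y = 0 → y ∈ P' := by
    intro y hy h0
    have h1 : Φ.symm y ∈ P := hcomplete _ hy ((hcritiff y).1 h0)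
    exact Finset.mem_image.2 ⟨Φ.symm y, h1, Φ.apply_symm_apply y⟩
  have hPc : ∀ p ∈ P, g p = c := by
    intro p hp
    have h0 : (0 : EuclideanSpace ℝ (Fin (m + 1))) ∈ (e₀ p).target := hball₀ p hp (Metric.mem_closedBall_self hR.le)
    have h1 := hquad₀ p hp 0 h0
    have h2 : (e₀ p).symm 0 = p := by
      rw [← (hpe₀ p hp).2, (e₀ p).left_inv (hpe₀ p hp).1]
    rw [h2] at h1
    simpa [sqSumLT, sqSumGE] using h1
  have hP'c : ∀ q ∈ P', gs q = c := fun q hq => by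
    show g (Φ.symm q) = c; exact hPc _ (hmemP' q hq)
  -- 1. charts for `gs` at `P'`
  obtain ⟨e, he, hpe, hball, hquad, hdisj, -, -, -, -⟩ :=
    exists_morseCharts_transport Φ P lam e₀ he₀ hpe₀ hball₀ hquad₀ hdisj₀
  set lam' : EuclideanSpace ℝ (Fin (m + 1)) → ℕ := fun q => lam (Φ.symm q) with hlam'
  have hlam'' : ∀ q ∈ P', lam' q + 1 ≤ m := fun q hq => hlam _ (hmemP' q hq)
  -- 2. the open set `U = {gs < c + ε}` and the descending discs
  set U : Set (EuclideanSpace ℝ (Fin (m + 1))) := {y | gs y < c + ε} with hU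
  have hUo : IsOpen U := isOpen_lt hgsc.continuous continuous_const
  have hεR : ε ≤ R ^ 2 := by linarith
  have hdiscU : ∀ q ∈ P', ∀ y : EuclideanSpace ℝ (Fin (m + 1)), (∀ i : Fin (m + 1), lam' q ≤ i.val → y i = 0) →
      sqSumLT (lam' q) y ≤ ε → (e q).symm y ∈ U := by
    intro q hq y hpl hξ
    have hyR : y ∈ Metric.closedBall (0 : EuclideanSpace ℝ (Fin (m + 1))) R := by
      rw [Metric.mem_closedBall, dist_zero_right]
      refine (pow_le_pow_iff_left₀ (norm_nonneg _) hR.le two_ne_zero).1 ?_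
      rw [norm_sq_eq_sqSumLT_of_plane hpl]; linarith
    have h1 := hquad q hq y (hball q hq hyR)
    show gs ((e q).symm y) < c + ε
    change gs ((e q).symm y) = _ at h1
    rw [h1, sqSumGE_eq_zero_of_plane hpl]
    linarith [sqSumLT_nonneg (lam' q) y]
  -- 3. the hypotheses of `hG1`
  have hXc : IsCompact {y | gs y ≤ c + ε} := hgscpt _ (by linarith)
  have hGset' : {x | G x ≤ 0} = {y | gs y ≤ c - ε} := by rw [hGset, himg]
  have hgsreg : ∀ y, gs y = c - ε → fderiv ℝ gs y ≠ 0 := by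
    intro y hy h0
    have h1 : y ∈ P' := hcomplete' y (by rw [hy]; constructor <;> linarith) h0
    have := hP'c y h1
    linarith
  obtain ⟨e', G', he', hpe', hball', hquad', hdisj', hG'c, hG'U, hXX', hdisc', hG'cpt, hG'reg,
      hG'mc, δ, hδ, hcert⟩ :=
    hG1 gs G c ε R P' lam' e U hgsc hGc hε hR (by linarith) hlam'' he hpe hball hquad hdisj hXc
      hGset' hGcpt hgsreg hGreg hGmc hUo hdiscU
  have hG'cont : Continuous G' := hG'c.continuous
  have hG'd : Differentiable ℝ G' := hG'c.differentiable (by simp)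
  -- 4. the enlarged `ε₂`
  set δ₂ : ℝ := min (δ / 2) (ε / 8) with hδ₂
  have hδ₂pos : 0 < δ₂ := lt_min (by positivity) (by positivity)
  have hδ₂δ : δ₂ < δ := (min_le_left _ _).trans_lt (by linarith)
  have hδ₂ε : δ₂ ≤ ε / 8 := min_le_right _ _
  set ε₂ : ℝ := ε + δ₂ with hε₂
  have hε₂pos : 0 < ε₂ := by rw [hε₂]; linarith
  have hεε₂ : ε < ε₂ := by rw [hε₂]; linarith
  have hε₂le : ε₂ ≤ 9 / 8 * ε := by rw [hε₂]; linarith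
  have h2ε₂R : 2 * ε₂ ≤ R ^ 2 := by linarith
  -- 5. the open set `N = {G' < 0}` contains `{gs ≤ c - ε₂}` and the discs of radius² `ε₂`
  have hNo : IsOpen {y : EuclideanSpace ℝ (Fin (m + 1)) | G' y < 0} := isOpen_lt hG'cont continuous_const
  have hint : {y | gs y < c - ε} ⊆ {y | G' y < 0} := by
    have h1 : {y | gs y < c - ε} ⊆ {y | G' y ≤ 0} := fun y hy => hXX' y (le_of_lt hy)
    rw [← interior_setOf_nonpos_eq hG'cont hG'reg]
    exact interior_maximal h1 (isOpen_lt hgsc.continuous continuous_const)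
  have hNf : gs ⁻¹' Iic (c - ε₂) ⊆ {y | G' y < 0} := fun y hy =>
    hint (show gs y < c - ε from lt_of_le_of_lt hy (by linarith))
  have hND : ∀ q ∈ P', ∀ y : EuclideanSpace ℝ (Fin (m + 1)), (∀ i : Fin (m + 1), lam' q ≤ i.val → y i = 0) →
      sqSumLT (lam' q) y ≤ ε₂ → (e' q).symm y ∈ {y : EuclideanSpace ℝ (Fin (m + 1)) | G' y < 0} := by
    intro q hq y hpl hξ
    by_cases hξε : sqSumLT (lam' q) y ≤ ε
    · exact hdisc' q hq y hpl hξε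
    · rw [not_le] at hξε
      have hyR : y ∈ Metric.closedBall (0 : EuclideanSpace ℝ (Fin (m + 1))) R := by
        rw [Metric.mem_closedBall, dist_zero_right]
        refine (pow_le_pow_iff_left₀ (norm_nonneg _) hR.le two_ne_zero).1 ?_
        rw [norm_sq_eq_sqSumLT_of_plane hpl]; linarith
      have h1 := hquad' q hq y (hball' q hq hyR)
      refine hint ?_
      show gs ((e' q).symm y) < c - ε
      change gs ((e' q).symm y) = _ at h1
      rw [h1, sqSumGE_eq_zero_of_plane hpl]
      linarith
  -- 6. Milnor's thin-handle function
  have hgsM : ContMDiff (𝓡 (m + 1)) 𝓘(ℝ, ℝ) ∞ gs := hgsc.contMDiff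
  obtain ⟨Fth, hFthM, hFle, hfle, hA1, hA3, hoff, hcentre, hcritF, hT5, -⟩ :=
    exists_thinHandleFunction' hgsM hε₂pos hR h2ε₂R P' lam' e' he' hpe' hball' hquad' hdisj'
      hNo hNf hND
  have hFthc : ContDiff ℝ ∞ Fth := contMDiff_iff_contDiff.1 hFthM
  have hFthd : Differentiable ℝ Fth := hFthc.differentiable (by simp)
  -- regular values of `Fth` in `[c - ε₂, c + ε₂]`
  have hFreg : ∀ y, Fth y ∈ Icc (c - ε₂) (c + ε₂) → fderiv ℝ Fth y ≠ 0 := by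
    intro y hy h0
    have hcrit : IsMCriticalPt (𝓡 (m + 1)) Fth y := by
      show mfderiv (𝓡 (m + 1)) 𝓘(ℝ, ℝ) Fth y = 0
      rw [_root_.mfderiv_eq_fderiv]; exact h0
    by_cases hyP : y ∈ P'
    · have := hcentre y hyP; linarith [hy.1]
    · obtain ⟨hcg, hFg⟩ := hcritF y hcrit hyP
      have h0' : fderiv ℝ gs y = 0 := by
        have h := hcg
        unfold IsMCriticalPt at h
        rwa [_root_.mfderiv_eq_fderiv] at h
      have hval : gs y ∈ Icc (c - 4 * ε) (c + 4 * ε) := by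
        rw [← hFg]; exact ⟨by linarith [hy.1], by linarith [hy.2]⟩
      exact hyP (hcomplete' y hval h0')
  -- 7. the first family: `Fth - (c - ε₂ + 2ε₂τ)`
  set K₁ : Set (EuclideanSpace ℝ (Fin (m + 1))) := {y | gs y ≤ c + 5 * ε} with hK₁
  have hK₁c : IsCompact K₁ := hgscpt _ (by linarith)
  set Fam₁ : ℝ × EuclideanSpace ℝ (Fin (m + 1)) → ℝ := fun q => Fth q.2 - (c - ε₂ + q.1 * (2 * ε₂)) with hFam₁
  have hFam₁c : ContDiff ℝ ∞ Fam₁ :=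
    (hFthc.comp contDiff_snd).sub (contDiff_const.add (contDiff_fst.mul contDiff_const))
  have hFam₁τ : ∀ τ, (fun y => Fam₁ (τ, y)) = fun y => Fth y - (c - ε₂ + τ * (2 * ε₂)) :=
    fun τ => rfl
  have hreg₁ : ∀ τ ∈ Icc (0 : ℝ) 1, ∀ x, Fam₁ (τ, x) = 0 →
      fderiv ℝ (fun y => Fam₁ (τ, y)) x ≠ 0 := by
    intro τ hτ x hx
    rw [hFam₁τ, fderiv_sub_const]
    refine hFreg x ?_
    change Fth x - (c - ε₂ + τ * (2 * ε₂)) = 0 at hx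
    constructor <;> nlinarith [hτ.1, hτ.2]
  have hKF₁ : ∀ τ ∈ Icc (0 : ℝ) 1, ∀ x, |Fam₁ (τ, x)| ≤ ε → x ∈ K₁ := by
    intro τ hτ x hx
    have h1 := (abs_le.1 hx).2
    change Fth x - (c - ε₂ + τ * (2 * ε₂)) ≤ ε at h1
    have h2 := hfle x
    have h3 : τ * (2 * ε₂) ≤ 2 * ε₂ := by nlinarith [hτ.2]
    show gs x ≤ c + 5 * ε
    linarith
  obtain ⟨Ψ₁, hΨ₁le, -, -, -, hΨ₁K⟩ :=
    RegularFamily.exists_diffeomorph_image_eq hFam₁c hK₁c hε hKF₁ hreg₁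
  have hY₀ : {x | Fam₁ (0, x) ≤ 0} = {y | Fth y ≤ c - ε₂} := by
    ext y
    show Fth y - (c - ε₂ + 0 * (2 * ε₂)) ≤ 0 ↔ Fth y ≤ c - ε₂
    constructor <;> intro h <;> linarith
  have hY₁ : {x | Fam₁ (1, x) ≤ 0} = {y | gs y ≤ c + ε₂} := by
    ext y
    show Fth y - (c - ε₂ + 1 * (2 * ε₂)) ≤ 0 ↔ gs y ≤ c + ε₂
    constructor
    · intro h; exact hA1 y (by linarith)
    · intro h; linarith [hFle y]
  rw [hY₀, hY₁] at hΨ₁le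
  -- 8. the second family: `(1 - τ)(Fth - (c - ε₂)) + τ G'`
  -- its small values lie in `K₁`
  obtain ⟨s', hs', hG'cpt'⟩ := hG'cpt
  have hG'O : {y | G' y ≤ 0} ⊆ U := by
    intro y hy
    by_cases h : G' y = G y
    · have h1 : G y ≤ 0 := by rw [← h]; exact hy
      have h2 : gs y ≤ c - ε := by
        have : y ∈ {x | G x ≤ 0} := h1
        rw [hGset'] at this; exact this
      show gs y < c + ε; linarith
    · exact hG'U h
  obtain ⟨s₀, hs₀, -, hs₀U⟩ := exists_setOf_le_subset hG'cont hs' hG'cpt' hUo hG'O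
  set Fam₂ : ℝ × EuclideanSpace ℝ (Fin (m + 1)) → ℝ := fun q => (1 - q.1) * (Fth q.2 - (c - ε₂)) + q.1 * G' q.2 with hFam₂
  have hFam₂c : ContDiff ℝ ∞ Fam₂ :=
    ((contDiff_const.sub contDiff_fst).mul ((hFthc.comp contDiff_snd).sub contDiff_const)).add
      (contDiff_fst.mul (hG'c.comp contDiff_snd))
  have hD₂ : ∀ τ y, HasFDerivAt (fun z => Fam₂ (τ, z))
      ((1 - τ) • fderiv ℝ Fth y + τ • fderiv ℝ G' y) y := by
    intro τ y
    have h1 : HasFDerivAt (fun z => (1 - τ) * (Fth z - (c - ε₂))) ((1 - τ) • fderiv ℝ Fth y) y :=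
      ((hFthd y).hasFDerivAt.sub_const (c - ε₂)).const_mul (1 - τ)
    have h2 : HasFDerivAt (fun z => τ * G' z) (τ • fderiv ℝ G' y) y :=
      (hG'd y).hasFDerivAt.const_mul τ
    exact h1.add h2
  set ε₀ : ℝ := min ε s₀ with hε₀
  have hε₀pos : 0 < ε₀ := lt_min hε hs₀
  have hKF₂ : ∀ τ ∈ Icc (0 : ℝ) 1, ∀ x, |Fam₂ (τ, x)| ≤ ε₀ → x ∈ K₁ := by
    intro τ hτ x hx
    have h1 := (abs_le.1 hx).2
    change (1 - τ) * (Fth x - (c - ε₂)) + τ * G' x ≤ ε₀ at h1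
    have hε₀ε : ε₀ ≤ ε := min_le_left _ _
    have hε₀s : ε₀ ≤ s₀ := min_le_right _ _
    by_cases hK : Fth x - (c - ε₂) ≤ ε₀
    · show gs x ≤ c + 5 * ε
      linarith [hfle x]
    · rw [not_le] at hK
      have hτpos : 0 < τ := by
        by_contra h
        have hτ0 : τ = 0 := le_antisymm (not_lt.1 h) hτ.1
        rw [hτ0] at h1; simp at h1; linarith
      have h2 : (1 - τ) * ε₀ ≤ (1 - τ) * (Fth x - (c - ε₂)) :=
        mul_le_mul_of_nonneg_left hK.le (by linarith [hτ.2])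
      have hprod : τ * G' x ≤ τ * ε₀ := by linarith
      have hGx : G' x ≤ ε₀ := le_of_mul_le_mul_left hprod hτpos
      have hxU : x ∈ U := hs₀U (show G' x ≤ s₀ by linarith)
      show gs x ≤ c + 5 * ε
      have : gs x < c + ε := hxU
      linarith
  -- regularity of the second family: the transversality certificate
  have hreg₂ : ∀ τ ∈ Icc (0 : ℝ) 1, ∀ y, Fam₂ (τ, y) = 0 →
      fderiv ℝ (fun z => Fam₂ (τ, z)) y ≠ 0 := by
    intro τ hτ y hy0
    change (1 - τ) * (Fth y - (c - ε₂)) + τ * G' y = 0 at hy0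
    rw [(hD₂ τ y).fderiv]
    rcases le_or_gt (Fth y - (c - ε₂)) 0 with hK | hK
    · -- `Fth y ≤ c - ε₂`: then `G' y < 0`, which forces `τ = 0` and `Fth y = c - ε₂`
      have hGneg : G' y < 0 := hA3 (show Fth y ≤ c - ε₂ by linarith)
      have hτ0 : τ = 0 := by
        by_contra hne
        have hτpos : 0 < τ := lt_of_le_of_ne hτ.1 (Ne.symm hne)
        have h1 : τ * G' y < 0 := mul_neg_of_pos_of_neg hτpos hGneg
        have h2 : (1 - τ) * (Fth y - (c - ε₂)) ≤ 0 :=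
          mul_nonpos_of_nonneg_of_nonpos (by linarith [hτ.2]) hK
        linarith
      rw [hτ0] at hy0 ⊢
      have hval : Fth y = c - ε₂ := by linarith
      simp only [sub_zero, one_smul, zero_smul, add_zero]
      exact hFreg y ⟨le_of_eq hval.symm, by linarith⟩
    · -- `Fth y > c - ε₂`
      have hgsy : c - ε - δ < gs y := by linarith [hFle y]
      rcases eq_or_lt_of_le hτ.2 with hτ1 | hτ1
      · -- `τ = 1`: the family is `G'`
        rw [hτ1] at hy0 ⊢
        have hG0 : G' y = 0 := by linarith
        simp only [sub_self, zero_smul, one_smul, zero_add]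
        exact hG'reg y hG0
      · have hprod : τ * G' y < 0 := by nlinarith [mul_pos (sub_pos.2 hτ1) hK]
        have hGneg : G' y < 0 := by
          rcases mul_neg_iff.1 hprod with h | h
          · exact h.2
          · exact absurd h.1 (not_lt.2 hτ.1)
        rcases hcert y hGneg.le hgsy with ⟨hyB, v, hv1, hv2⟩ | ⟨q, hq, y₀, hy₀, hyq, hmv⟩
        · -- off the chart balls: `Fth = gs` near `y`
          have hev : Fth =ᶠ[𝓝 y] gs := by
            have hclosed : IsClosed (⋃ p ∈ P', (e' p).symm '' Metric.closedBall (0 : EuclideanSpace ℝ (Fin (m + 1))) R) :=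
              isClosed_biUnion_finset fun p hp =>
                (isCompact_symm_image_closedBall (hball' p hp)).2.1
            filter_upwards [hclosed.isOpen_compl.mem_nhds hyB] with z hz
            exact hoff z fun p hp hzp => hz (mem_iUnion₂.2 ⟨p, hp, hzp⟩)
          rw [hev.fderiv_eq]
          intro h0
          have h1 : ((1 - τ) • fderiv ℝ gs y + τ • fderiv ℝ G' y) v = 0 := by rw [h0]; rfl
          have h2 : ((1 - τ) • fderiv ℝ gs y + τ • fderiv ℝ G' y) v =
              (1 - τ) * fderiv ℝ gs y v + τ * fderiv ℝ G' y v := rfl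
          rw [h2] at h1
          have h3 : 0 < (1 - τ) * fderiv ℝ gs y v := mul_pos (sub_pos.2 hτ1) hv1
          have h4 : 0 ≤ τ * fderiv ℝ G' y v := mul_nonneg hτ.1 hv2
          linarith
        · -- in a chart ball: Milnor's field is a common transversal
          have hy₀ne : y₀ ≠ 0 := by
            intro h0
            have hyq' : y = q := by
              rw [hyq, h0, ← (hpe' q hq).2, (e' q).left_inv (hpe' q hq).1]
            have := hcentre q hq
            rw [← hyq'] at this
            linarith
          obtain ⟨a, b, ha, hb, hab, hB⟩ := hmv hy₀ne
          have hA := hT5 q hq y₀ hy₀ a b ha hb hab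
          have hy₀t : y₀ ∈ (e' q).target := hball' q hq hy₀
          have hsd : DifferentiableAt ℝ (e' q).symm y₀ := by
            have h := contMDiffOn_iff_contDiffOn.1 (contMDiffOn_symm_of_mem_maximalAtlas (he' q hq))
            exact (h.contDiffAt ((e' q).open_target.mem_nhds hy₀t)).differentiableAt (by simp)
          subst hyq
          intro h0
          -- the composite with the chart inverse has derivative `(1-τ) A + τ B > 0` on Milnor's field
          have hcomp : HasFDerivAt ((fun z => Fam₂ (τ, z)) ∘ (e' q).symm)
              (((1 - τ) • fderiv ℝ Fth ((e' q).symm y₀) + τ • fderiv ℝ G' ((e' q).symm y₀)).comp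
                (fderiv ℝ (e' q).symm y₀)) y₀ :=
            (hD₂ τ _).comp y₀ hsd.hasFDerivAt
          rw [h0, ContinuousLinearMap.zero_comp] at hcomp
          have hF1 : HasFDerivAt (Fth ∘ (e' q).symm)
              ((fderiv ℝ Fth ((e' q).symm y₀)).comp (fderiv ℝ (e' q).symm y₀)) y₀ :=
            (hFthd _).hasFDerivAt.comp y₀ hsd.hasFDerivAt
          have hG1' : HasFDerivAt (G' ∘ (e' q).symm)
              ((fderiv ℝ G' ((e' q).symm y₀)).comp (fderiv ℝ (e' q).symm y₀)) y₀ :=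
            (hG'd _).hasFDerivAt.comp y₀ hsd.hasFDerivAt
          have hcomp' : HasFDerivAt ((fun z => Fam₂ (τ, z)) ∘ (e' q).symm)
              ((1 - τ) • (fderiv ℝ Fth ((e' q).symm y₀)).comp (fderiv ℝ (e' q).symm y₀) +
                τ • (fderiv ℝ G' ((e' q).symm y₀)).comp (fderiv ℝ (e' q).symm y₀)) y₀ := by
            have h1 := (hF1.sub_const (c - ε₂)).const_mul (1 - τ)
            have h2 := hG1'.const_mul τ
            exact h1.add h2
          have heq := hcomp.unique hcomp'
          have h1 : ((1 - τ) • (fderiv ℝ Fth ((e' q).symm y₀)).comp (fderiv ℝ (e' q).symm y₀) +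
              τ • (fderiv ℝ G' ((e' q).symm y₀)).comp (fderiv ℝ (e' q).symm y₀))
                (a • milnorModelField (lam' q) y₀ + b • (y₀ + milnorModelField (lam' q) y₀)) = 0 := by
            rw [← heq]; rfl
          have h2 : ((1 - τ) • (fderiv ℝ Fth ((e' q).symm y₀)).comp (fderiv ℝ (e' q).symm y₀) +
              τ • (fderiv ℝ G' ((e' q).symm y₀)).comp (fderiv ℝ (e' q).symm y₀))
                (a • milnorModelField (lam' q) y₀ + b • (y₀ + milnorModelField (lam' q) y₀)) =
              (1 - τ) * ((fderiv ℝ Fth ((e' q).symm y₀)).comp (fderiv ℝ (e' q).symm y₀))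
                (a • milnorModelField (lam' q) y₀ + b • (y₀ + milnorModelField (lam' q) y₀)) +
              τ * ((fderiv ℝ G' ((e' q).symm y₀)).comp (fderiv ℝ (e' q).symm y₀))
                (a • milnorModelField (lam' q) y₀ + b • (y₀ + milnorModelField (lam' q) y₀)) := rfl
          rw [h2, ← hF1.fderiv, ← hG1'.fderiv] at h1
          have h3 : 0 < (1 - τ) * fderiv ℝ (Fth ∘ (e' q).symm) y₀
              (a • milnorModelField (lam' q) y₀ + b • (y₀ + milnorModelField (lam' q) y₀)) :=
            mul_pos (sub_pos.2 hτ1) hA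
          have h4 : 0 ≤ τ * fderiv ℝ (G' ∘ (e' q).symm) y₀
              (a • milnorModelField (lam' q) y₀ + b • (y₀ + milnorModelField (lam' q) y₀)) :=
            mul_nonneg hτ.1 hB
          linarith
  obtain ⟨Ψ₂, hΨ₂le, -, -, -, hΨ₂K⟩ :=
    RegularFamily.exists_diffeomorph_image_eq hFam₂c hK₁c hε₀pos hKF₂ hreg₂
  have hZ₀ : {x | Fam₂ (0, x) ≤ 0} = {y | Fth y ≤ c - ε₂} := by
    ext y
    show (1 - 0) * (Fth y - (c - ε₂)) + 0 * G' y ≤ 0 ↔ Fth y ≤ c - ε₂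
    constructor <;> intro h <;> linarith
  have hZ₁ : {x | Fam₂ (1, x) ≤ 0} = {y | G' y ≤ 0} := by
    ext y
    show (1 - 1) * (Fth y - (c - ε₂)) + 1 * G' y ≤ 0 ↔ G' y ≤ 0
    constructor <;> intro h <;> linarith
  rw [hZ₀, hZ₁] at hΨ₂le
  -- 9. depth of `K₁` and assembly
  have hSneg : ∀ x ∈ {x : EuclideanSpace ℝ (Fin (m + 1)) | g x ≤ c + 5 * ε}, F x < 0 := fun x hx =>
    hsub1 x (lt_of_le_of_lt hx hc5)
  obtain ⟨η₁, hη₁, hη₁S⟩ := exists_pos_forall_le_neg hF (hcpt _ (by linarith)) hSneg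
  have hKdeep : ∀ y ∈ K₁, F y ≤ -min η η₁ := by
    rw [hK₁, ← himg]; exact apply_image_le Φ hΦ hη₁S
  have hb1 : c + ε ≤ c + ε₂ := by linarith
  have hb2 : c + ε₂ ≤ c + 2 * ε := by linarith
  set Φ' := (Φ.trans Ψ₁.symm).trans Ψ₂ with hΦ'
  have hid : ∀ x, -min η η₁ < F x → Φ' x = x := by
    intro x hx
    have hxK : x ∉ K₁ := fun h => by have := hKdeep x h; linarith
    have h1 : Φ x = x := hΦ x (lt_of_le_of_lt (neg_le_neg (min_le_left _ _)) hx)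
    show Ψ₂ (Ψ₁.symm (Φ x)) = x
    rw [h1]
    have h2 : Ψ₁.symm x = x := by
      conv_lhs => rw [← hΨ₁K x hxK]
      exact Ψ₁.symm_apply_apply x
    rw [h2, hΨ₂K x hxK]
  have hset : {x | G' x ≤ 0} = Φ' '' {x | g x ≤ c + ε₂} := by
    rw [hΦ', Diffeomorph.coe_trans, Diffeomorph.coe_trans, image_comp, image_comp, himg, ← hΨ₁le,
      ← image_comp Ψ₁.symm]
    have : (Ψ₁.symm ∘ Ψ₁ : EuclideanSpace ℝ (Fin (m + 1)) → EuclideanSpace ℝ (Fin (m + 1))) = id :=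
      funext fun x => Ψ₁.symm_apply_apply x
    rw [this, image_id, hΨ₂le]
  exact ⟨c + ε₂, min η η₁, Φ', G', hb1, hb2, lt_min hη hη₁, hid, hG'c, hset, ⟨s', hs', hG'cpt'⟩,
    hG'reg, hG'mc⟩

end Literature.Geometry.Riemannian

end
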